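import Summits.BirchSwinnertonDyer.Rank1Residual.Additive.BudgetFromTamagawaCertificatesLayerAll
import Summits.BirchSwinnertonDyer.Rank1Residual.Additive.CongruentPartnerMainConjectureGordBSD
import Summits.BirchSwinnertonDyer.Rank1Residual.Additive.CongruentPartnerMainConjectureX3GordBSD
import Summits.BirchSwinnertonDyer.Rank1Residual.AdditivePotMult.PotMultBudgetRankZeroEnds
import Summits.BirchSwinnertonDyer.Rank1Residual.AdditivePotMult.PotMultX3BudgetRankZeroEnds
import Summits.BirchSwinnertonDyer.Rank1Residual.GaloisImage.EPCTateFormula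
import HarnessLib

/-!
# The four rank-0 class ENDs at `p = 3` fed with the LEVEL-`n` CERTIFICATE BUDGET
# (cell `b2b-bsdres`, team n1011, seat p16 GEN 5; row T-BUDn-END = r2 ROUTE-2 §II.21 ST-21.1,
# lead R5-59 deal; consumer ENDs of n1011-p10's MAIN `budgetLeLambdaAt_layer_of_certificates`)

HONEST FRAMING (cell `b2b-bsdres`, run/shared/lean/b2b/bsd-rank1-residual/, verbatim in every
file): the goal of the cell is to DELETE the COMBINATION-SHAPED residual classes of the
Birch–Swinnerton-Dyer formula for ALL analytic-rank `≤ 1` elliptic curves over `ℚ` — "full BSD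
formula for every rank `≤ 1` curve in class `C`" assembled STRICTLY from published theorems — so
that the rank-`≤ 1` remainder becomes exactly the CONSTRUCTION-SHAPED classes, which are TYPED
(missing-input `Prop`s), NOT attempted. This is not "finishing BSD". Team n1011 (N10 / N11, the
Route-G budget node): research route; no claim beyond the stated classes; X3 / X4 stay
CONSTRUCTION-SHAPED; nothing is booked; marks UNCHANGED; NOT a yield claim. Theorems only: no
definition, no named fact, no `sorry`; census certificates enter as HYPOTHESES per row, never as facts.

## What and why

n1011-p10's MAIN (`BudgetFromTamagawaCertificatesLayerAll`, row T-E3g-BUDn-CERT) turns a finite set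
`S` of Tamagawa places `v ∤ 3` of `ℚ` — each with a place-count certificate
`v₃(N(v)² − 1) = m_v + 1`, `3 ∣ c_v`, and additive OR split multiplicative reduction — into the Route-G
budget `BudgetLeLambdaAt 3 W (Σ_{v ∈ S} 3^{min(n, m_v)})` at any level `n`, modulo Greenberg Prop. 4.14,
Poitou–Tate over `ℚ_n`, the local Euler–Poincaré formula at the places of `ℚ_n`, and A40 (multiplicative
rows). The cell's rank-0 END shapes are "half + certificate@`b` + budget `b`"; this file plugs
`b := Σ_{v ∈ S} 3^{min(n, m_v)}` and `hbud := budgetLeLambdaAt_layer_of_certificates …` into the four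
class ENDs, one line each (r2 ST-21.1; prediction R2-F12's test shape):

* `ClassX4Gord.bsdp_three_rankZero_of_katoHalf_of_coeffCert_of_tamagawaCertificates_of_nonAnomalous`
  (N11 (G-ord) rows; parent p10's `…_of_coeffCert_of_budget_of_nonAnomalous_noPal`; `3 ∤ #E(ℚ)_tors`
  from `Surj`);
* `ClassX4M.bsdp_three_rankZero_of_surj_of_katoHalf_of_firstUnitIndex_of_tamagawaCertificates`
  (N11 (M) rows; parent p07's `…_of_firstUnitIndex_of_budget`);
* `ClassX3Gord.bsdp_three_rankZero_of_wuthrichHalf_of_coeffCert_of_tamagawaCertificates_of_nonAnomalous`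
  and `ClassX3M.bsdp_three_rankZero_of_wuthrichHalf_of_firstUnitIndex_of_tamagawaCertificates` (N10 X3♯
  rows; parents p12's / p07's; `E[3]` reducible, so `htors : 3 ∤ #E(ℚ)_tors` stays an explicit
  census bit).

Binders after composition: the parents' named facts (Kato 17.4 (3) half / Wuthrich Thm. 16 half,
Delbourgo 1998 Prop. 4, Delbourgo 2002 at 3, Pal where the parent keeps it, GZK, modularity) +
{`h414`, `hPT`, `hEP`, `hU`} + the per-row census LITERALS (`hval`, `hcv`, `hdat`, `hcert` / `hrec`,
`hna`, `hcm`, `htors` on X3) — EVIDENCE when instantiated; nothing is instantiated here.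
References: R. Greenberg, LNM 1716 (1999) §5 and Prop. 4.14; K. Kato, Astérisque 295 Thm. 17.4;
C. Wuthrich, Thm. 16; D. Delbourgo 1998 Prop. 4, 2002 Thm. (A)/(B); R. L. Miller 2011 Def. 1.1.
-/

set_option autoImplicit false

noncomputable section

open scoped Classical

open WeierstrassCurve NumberField IsDedekindDomain Literature.NumberTheory.EllipticCurves
  Literature.NumberTheory.EllipticCurves.ModularForms
  Literature.NumberTheory.EllipticCurves.Rank1Residual
  Literature.NumberTheory.EllipticCurves.Rank1Residual.Typed
  Literature.NumberTheory.EllipticCurves.Delbourgo2002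
  Literature.NumberTheory.GaloisRepresentations
  Literature.NumberTheory.GaloisCohomology
  Summit.BirchSwinnertonDyer.Rank1Residual.Iwasawa
  Summit.BirchSwinnertonDyer.Rank1Residual.Additive
  Summit.BirchSwinnertonDyer.Rank1Residual.Additive.CensusQ6
  Summit.BirchSwinnertonDyer.Rank1Residual.AdditivePotMult

/-! ## §1 The X4 ENDs (N11): `3 ∤ #E(ℚ)_tors` from `Surj` -/

namespace Summit.BirchSwinnertonDyer.Rank1Residual.Additive

/-- **X4♯(G-ord)@3 ∧ surj(3), `r_an = 0`, non-CM, non-anomalous: `BSD(E,3)` ⟸ ONE 3-adic unit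
coefficient at index `b = Σ_{v ∈ S} 3^{min(n, m_v)}` + the LEVEL-`n` CERTIFICATE BUDGET on `S`** —
p10's `…_of_coeffCert_of_budget_of_nonAnomalous_noPal` with
`hbud := budgetLeLambdaAt_layer_of_certificates …` (each `v ∈ S`: `v ∤ 3`, place count `hval`,
`3 ∣ c_v` (`hcv`), additive or split multiplicative (`hdat`)). Named facts: Kato's half `hK`, Delbourgo
1998 Prop. 4, Delbourgo 2002 at 3, GZK, modularity, Greenberg 4.14, PT over `ℚ_n`, EP at the places of
`ℚ_n`, A40 (multiplicative rows). Closes no class; literals per row.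
[cite: GreenbergLNM1716, §5 pp. 114–118 and Prop. 4.14] [cite: Kato2004Asterisque, Thm. 17.4 (3) (p. 273)]
[cite: Delbourgo2002, Theorem (A), (B) (p. 40), Hypothesis (p. 39)] [cite: Miller2011LMS, §1 and Def. 1.1] -/
theorem ClassX4Gord.bsdp_three_rankZero_of_katoHalf_of_coeffCert_of_tamagawaCertificates_of_nonAnomalous
    [Fact (Nat.Prime 3)] {W : WeierstrassCurve ℚ} [W.IsElliptic] [W.IsGloballyMinimal]
    (hK : Wuthrich2014.kato_halfEigenCharIdeal_dvd_cyclotomicPrime_of_surjective)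
    (hDel98 : Delbourgo1998.prop4_rankZero_pow_dvd_constantCoeff)
    (hDel3 : Delbourgo2002.mainTheorem_three)
    (hGZK : rank_eq_analyticRank_of_analyticRank_le_one) (hmod : hasEntireLFunction_rat)
    (hmodD : nonempty_modularParametrizationData)
    (h414 : Greenberg1999.prop414_noFiniteSubmodule_of_not_dvd_torsionOrder)
    (hU : Silverman1994_thmV53_tateUniformisation.{0}) (n : ℕ)
    (hPT : ∀ (κ : ZpExtension ℚ 3) [NumberField (κ.layer n)], κ.IsCyclotomic →
      poitouTate_selmerStructure_duality (κ.layer n))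
    (hEP : ∀ (κ : ZpExtension ℚ 3) [NumberField (κ.layer n)], κ.IsCyclotomic →
      ∀ w : HeightOneSpectrum (𝓞 (κ.layer n)),
      localEulerPoincareCharacteristic (w.adicCompletion (κ.layer n)))
    (hX : ClassX4Gord W 3) (hcm : ¬ W.HasCM) (hsurj : Surj W 3) (hr : W.analyticRank = 0)
    (S : Finset (HeightOneSpectrum (𝓞 ℚ))) (m : HeightOneSpectrum (𝓞 ℚ) → ℕ)
    (hSp : ∀ v ∈ S, ((3 : ℕ) : 𝓞 ℚ) ∉ v.asIdeal)
    (hval : ∀ v ∈ S, padicValNat 3 (v.residueCard ^ (3 - 1) - 1) = m v + 1)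
    (hcv : ∀ v ∈ S,
      3 ∣ (W.baseChange (v.adicCompletion ℚ)).localTamagawaNumber (v.adicCompletionIntegers ℚ))
    (hdat : ∀ v ∈ S, W.HasAdditiveReductionAt v ∨ W.HasSplitMultiplicativeReductionAt v)
    (hcert : BranchUnitCoeffAt W 3 (∑ v ∈ S, 3 ^ min n (m v)))
    (hna : ReductionNonAnomalous W 3) : BSDp W 3 :=
  ClassX4Gord.bsdp_three_rankZero_of_katoHalf_of_coeffCert_of_budget_of_nonAnomalous_noPal hK hDel98
    hDel3 hGZK hmod hmodD hX hcm hsurj hr hcert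
    (budgetLeLambdaAt_layer_of_certificates (by decide) h414 (not_dvd_torsionOrder_of_surj 3 W hsurj)
      hU n hPT hEP S m hSp hval hcv hdat) hna

end Summit.BirchSwinnertonDyer.Rank1Residual.Additive

namespace Summit.BirchSwinnertonDyer.Rank1Residual.AdditivePotMult

open Summit.BirchSwinnertonDyer.Rank1Residual.Additive

/-- **X4(M)@3 ∧ surj(3), `r_an = 0`: `BSD(E,3)` ⟸ the odd first-unit-index record at
`b = Σ_{v ∈ S} 3^{min(n, m_v)}` + the LEVEL-`n` CERTIFICATE BUDGET on `S`** — p07's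
`…_of_firstUnitIndex_of_budget` with `hbud := budgetLeLambdaAt_layer_of_certificates …`. Named facts:
Kato's half, Delbourgo 1998 Prop. 4 (+ the (M) reading `hDelX`), Pal (kept by the parent's parity-uniform
chain, idle at 3), GZK, modularity, Greenberg 4.14, PT, EP, A40. Closes no class; literals per row.
[cite: GreenbergLNM1716, §5 pp. 114–118 and Prop. 4.14] [cite: Kato2004Asterisque, Thm. 17.4 (3) (p. 273)]
[cite: Delbourgo1998, Prop. 4 (p. 144)] [cite: Miller2011LMS, §1 and Def. 1.1] -/
theorem ClassX4M.bsdp_three_rankZero_of_surj_of_katoHalf_of_firstUnitIndex_of_tamagawaCertificates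
    [Fact (Nat.Prime 3)] {W : WeierstrassCurve ℚ} [W.IsElliptic] [W.IsGloballyMinimal]
    (hK : Wuthrich2014.kato_halfEigenCharIdeal_dvd_cyclotomicPrime_of_surjective)
    (hDel : Delbourgo1998.prop4_rankZero_pow_dvd_constantCoeff)
    (hDelX : Delbourgo1998.prop4_rankZero_constantCoeff_eq_unit_mul_of_potMult)
    (hPal : Pal2012.thm32_sqrt_mul_realPeriodRat_twist_eq_of_prime_one_mod_four)
    (hGZK : rank_eq_analyticRank_of_analyticRank_le_one) (hmod : hasEntireLFunction_rat)
    (hmodD : nonempty_modularParametrizationData)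
    (h414 : Greenberg1999.prop414_noFiniteSubmodule_of_not_dvd_torsionOrder)
    (hU : Silverman1994_thmV53_tateUniformisation.{0}) (n : ℕ)
    (hPT : ∀ (κ : ZpExtension ℚ 3) [NumberField (κ.layer n)], κ.IsCyclotomic →
      poitouTate_selmerStructure_duality (κ.layer n))
    (hEP : ∀ (κ : ZpExtension ℚ 3) [NumberField (κ.layer n)], κ.IsCyclotomic →
      ∀ w : HeightOneSpectrum (𝓞 (κ.layer n)),
      localEulerPoincareCharacteristic (w.adicCompletion (κ.layer n)))
    (hX : ClassX4M W 3) (hsurj : Surj W 3) (hr : W.analyticRank = 0)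
    (S : Finset (HeightOneSpectrum (𝓞 ℚ))) (m : HeightOneSpectrum (𝓞 ℚ) → ℕ)
    (hSp : ∀ v ∈ S, ((3 : ℕ) : 𝓞 ℚ) ∉ v.asIdeal)
    (hval : ∀ v ∈ S, padicValNat 3 (v.residueCard ^ (3 - 1) - 1) = m v + 1)
    (hcv : ∀ v ∈ S,
      3 ∣ (W.baseChange (v.adicCompletion ℚ)).localTamagawaNumber (v.adicCompletionIntegers ℚ))
    (hdat : ∀ v ∈ S, W.HasAdditiveReductionAt v ∨ W.HasSplitMultiplicativeReductionAt v)
    (hrec : MultOddFirstUnitIndexAt W 3 (∑ v ∈ S, 3 ^ min n (m v))) : BSDp W 3 :=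
  hX.bsdp_three_rankZero_of_surj_of_katoHalf_of_firstUnitIndex_of_budget hK hDel hDelX hPal hGZK hmod
    hmodD hsurj hr hrec
    (budgetLeLambdaAt_layer_of_certificates (by decide) h414 (not_dvd_torsionOrder_of_surj 3 W hsurj)
      hU n hPT hEP S m hSp hval hcv hdat)

end Summit.BirchSwinnertonDyer.Rank1Residual.AdditivePotMult

/-! ## §2 The X3♯ ENDs (N10): `E[3]` reducible, `htors : 3 ∤ #E(ℚ)_tors` an explicit census bit -/

namespace Summit.BirchSwinnertonDyer.Rank1Residual.Additive

/-- **X3♯(G-ord)@3, `r_an = 0`, non-CM, non-anomalous, `3 ∤ #E(ℚ)_tors`: `BSD(E,3)` ⟸ ONE 3-adic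
unit coefficient at index `b = Σ_{v ∈ S} 3^{min(n, m_v)}` + the LEVEL-`n` CERTIFICATE BUDGET on `S`**
— p12's `…_of_wuthrichHalf_of_coeffCert_of_budget_of_nonAnomalous` with
`hbud := budgetLeLambdaAt_layer_of_certificates …`; NO image hypothesis (Wuthrich's Thm. 16 half);
`htors` is a census bit on these reducible rows. Named facts: Wuthrich Thm. 16, Delbourgo 1998 Prop. 4,
Delbourgo 2002 at 3, GZK, modularity, Greenberg 4.14, PT, EP, A40. Closes no class; literals per row.
[cite: GreenbergLNM1716, §5 pp. 114–118 and Prop. 4.14] [cite: Wuthrich2014, Thm. 16 (p. 397)]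
[cite: Delbourgo2002, Theorem (A), (B) (p. 40), Hypothesis (p. 39)] [cite: Miller2011LMS, §1 and Def. 1.1] -/
theorem ClassX3Gord.bsdp_three_rankZero_of_wuthrichHalf_of_coeffCert_of_tamagawaCertificates_of_nonAnomalous
    [Fact (Nat.Prime 3)] {W : WeierstrassCurve ℚ} [W.IsElliptic] [W.IsGloballyMinimal]
    (hWu : Wuthrich2014.thm16_halfEigenCharIdeal_dvd_cyclotomicPrime)
    (hDel98 : Delbourgo1998.prop4_rankZero_pow_dvd_constantCoeff)
    (hDel3 : Delbourgo2002.mainTheorem_three)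
    (hGZK : rank_eq_analyticRank_of_analyticRank_le_one) (hmod : hasEntireLFunction_rat)
    (hmodD : nonempty_modularParametrizationData)
    (h414 : Greenberg1999.prop414_noFiniteSubmodule_of_not_dvd_torsionOrder)
    (hU : Silverman1994_thmV53_tateUniformisation.{0}) (n : ℕ)
    (hPT : ∀ (κ : ZpExtension ℚ 3) [NumberField (κ.layer n)], κ.IsCyclotomic →
      poitouTate_selmerStructure_duality (κ.layer n))
    (hEP : ∀ (κ : ZpExtension ℚ 3) [NumberField (κ.layer n)], κ.IsCyclotomic →
      ∀ w : HeightOneSpectrum (𝓞 (κ.layer n)),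
      localEulerPoincareCharacteristic (w.adicCompletion (κ.layer n)))
    (hX : ClassX3Gord W 3) (hcm : ¬ W.HasCM) (htors : ¬ 3 ∣ W.torsionOrder) (hr : W.analyticRank = 0)
    (S : Finset (HeightOneSpectrum (𝓞 ℚ))) (m : HeightOneSpectrum (𝓞 ℚ) → ℕ)
    (hSp : ∀ v ∈ S, ((3 : ℕ) : 𝓞 ℚ) ∉ v.asIdeal)
    (hval : ∀ v ∈ S, padicValNat 3 (v.residueCard ^ (3 - 1) - 1) = m v + 1)
    (hcv : ∀ v ∈ S,
      3 ∣ (W.baseChange (v.adicCompletion ℚ)).localTamagawaNumber (v.adicCompletionIntegers ℚ))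
    (hdat : ∀ v ∈ S, W.HasAdditiveReductionAt v ∨ W.HasSplitMultiplicativeReductionAt v)
    (hcert : BranchUnitCoeffAt W 3 (∑ v ∈ S, 3 ^ min n (m v)))
    (hna : ReductionNonAnomalous W 3) : BSDp W 3 :=
  ClassX3Gord.bsdp_three_rankZero_of_wuthrichHalf_of_coeffCert_of_budget_of_nonAnomalous hWu hDel98 hDel3
    hGZK hmod hmodD hX hcm hr hcert
    (budgetLeLambdaAt_layer_of_certificates (by decide) h414 htors hU n hPT hEP S m hSp hval hcv hdat)
    hna

end Summit.BirchSwinnertonDyer.Rank1Residual.Additive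

namespace Summit.BirchSwinnertonDyer.Rank1Residual.AdditivePotMult

open Summit.BirchSwinnertonDyer.Rank1Residual.Additive

/-- **X3♯(M)@3, `r_an = 0`, `3 ∤ #E(ℚ)_tors`: `BSD(E,3)` ⟸ the odd first-unit-index record at
`b = Σ_{v ∈ S} 3^{min(n, m_v)}` + the LEVEL-`n` CERTIFICATE BUDGET on `S`** — p07's
`ClassX3M.…_of_wuthrichHalf_of_firstUnitIndex_of_budget` with
`hbud := budgetLeLambdaAt_layer_of_certificates …`; NO image hypothesis, NO Pal; `htors` a census bit.
Named facts: Wuthrich Thm. 16, Delbourgo 1998 Prop. 4 (+ `hDelX`), GZK, modularity, Greenberg 4.14,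
PT, EP, A40. Closes no class; literals per row.
[cite: GreenbergLNM1716, §5 pp. 114–118 and Prop. 4.14] [cite: Wuthrich2014, Thm. 16 (p. 397)]
[cite: Delbourgo1998, Prop. 4 (p. 144)] [cite: Miller2011LMS, §1 and Def. 1.1] -/
theorem ClassX3M.bsdp_three_rankZero_of_wuthrichHalf_of_firstUnitIndex_of_tamagawaCertificates
    [Fact (Nat.Prime 3)] {W : WeierstrassCurve ℚ} [W.IsElliptic] [W.IsGloballyMinimal]
    (hW16 : Wuthrich2014.thm16_halfEigenCharIdeal_dvd_cyclotomicPrime)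
    (hDel : Delbourgo1998.prop4_rankZero_pow_dvd_constantCoeff)
    (hDelX : Delbourgo1998.prop4_rankZero_constantCoeff_eq_unit_mul_of_potMult)
    (hGZK : rank_eq_analyticRank_of_analyticRank_le_one) (hmod : hasEntireLFunction_rat)
    (hmodD : nonempty_modularParametrizationData)
    (h414 : Greenberg1999.prop414_noFiniteSubmodule_of_not_dvd_torsionOrder)
    (hU : Silverman1994_thmV53_tateUniformisation.{0}) (n : ℕ)
    (hPT : ∀ (κ : ZpExtension ℚ 3) [NumberField (κ.layer n)], κ.IsCyclotomic →
      poitouTate_selmerStructure_duality (κ.layer n))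
    (hEP : ∀ (κ : ZpExtension ℚ 3) [NumberField (κ.layer n)], κ.IsCyclotomic →
      ∀ w : HeightOneSpectrum (𝓞 (κ.layer n)),
      localEulerPoincareCharacteristic (w.adicCompletion (κ.layer n)))
    (hX : ClassX3M W 3) (htors : ¬ 3 ∣ W.torsionOrder) (hr : W.analyticRank = 0)
    (S : Finset (HeightOneSpectrum (𝓞 ℚ))) (m : HeightOneSpectrum (𝓞 ℚ) → ℕ)
    (hSp : ∀ v ∈ S, ((3 : ℕ) : 𝓞 ℚ) ∉ v.asIdeal)
    (hval : ∀ v ∈ S, padicValNat 3 (v.residueCard ^ (3 - 1) - 1) = m v + 1)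
    (hcv : ∀ v ∈ S,
      3 ∣ (W.baseChange (v.adicCompletion ℚ)).localTamagawaNumber (v.adicCompletionIntegers ℚ))
    (hdat : ∀ v ∈ S, W.HasAdditiveReductionAt v ∨ W.HasSplitMultiplicativeReductionAt v)
    (hrec : MultOddFirstUnitIndexAt W 3 (∑ v ∈ S, 3 ^ min n (m v))) : BSDp W 3 :=
  hX.bsdp_three_rankZero_of_wuthrichHalf_of_firstUnitIndex_of_budget hW16 hDel hDelX hGZK hmod hmodD hr
    hrec
    (budgetLeLambdaAt_layer_of_certificates (by decide) h414 htors hU n hPT hEP S m hSp hval hcv hdat)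

end Summit.BirchSwinnertonDyer.Rank1Residual.AdditivePotMult

/-! ## §3 (append, seat p16 GEN 8, lead R5-75 (b)(i)) The four ENDs with `hEP` DISCHARGED

Row T-EPC (n1011-p04) settled Tate's local Euler–Poincaré characteristic formula in the kernel:
`Summit.BirchSwinnertonDyer.Rank1Residual.GaloisImage.EPCTate.localEulerPoincareCharacteristic`
(p300886, `GaloisImage/EPCTateFormula.lean`) proves the tree's `Prop`
`Literature.NumberTheory.GaloisRepresentations.localEulerPoincareCharacteristic F` for every
non-archimedean local field `F` of characteristic `0`, in particular for the completions of the layers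
`ℚ_n` of the cyclotomic `ℤ₃`-extension. The four ENDs of §1–§2 are restated WITHOUT the binder `hEP`,
one theorem per END ("hEP discharged by p300886"); every other binder is unchanged and displayed; the
ENDs still close no class and move no mark. -/

namespace Summit.BirchSwinnertonDyer.Rank1Residual.Additive

open Summit.BirchSwinnertonDyer.Rank1Residual.GaloisImage

/-- **X4♯(G-ord)@3 ∧ surj(3), `r_an = 0`, non-CM, non-anomalous — the END of §1 with `hEP`
discharged by p300886** (`EPCTate.localEulerPoincareCharacteristic` at every place of every layer
`ℚ_n`; Milne *ADT* I Thm. 2.8 proved in the tree by row T-EPC). All other binders verbatim as in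
`ClassX4Gord.bsdp_three_rankZero_of_katoHalf_of_coeffCert_of_tamagawaCertificates_of_nonAnomalous`.
Closes no class; literals per row.
[cite: GreenbergLNM1716, §5 pp. 114–118 and Prop. 4.14] [cite: Kato2004Asterisque, Thm. 17.4 (3) (p. 273)]
[cite: Delbourgo2002, Theorem (A), (B) (p. 40), Hypothesis (p. 39)] [cite: MilneADT2006, I §2 Thm 2.8 (p. 31)] -/
theorem ClassX4Gord.bsdp_three_rankZero_of_katoHalf_of_coeffCert_of_tamagawaCertificates_of_nonAnomalous_noEP
    [Fact (Nat.Prime 3)] {W : WeierstrassCurve ℚ} [W.IsElliptic] [W.IsGloballyMinimal]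
    (hK : Wuthrich2014.kato_halfEigenCharIdeal_dvd_cyclotomicPrime_of_surjective)
    (hDel98 : Delbourgo1998.prop4_rankZero_pow_dvd_constantCoeff)
    (hDel3 : Delbourgo2002.mainTheorem_three)
    (hGZK : rank_eq_analyticRank_of_analyticRank_le_one) (hmod : hasEntireLFunction_rat)
    (hmodD : nonempty_modularParametrizationData)
    (h414 : Greenberg1999.prop414_noFiniteSubmodule_of_not_dvd_torsionOrder)
    (hU : Silverman1994_thmV53_tateUniformisation.{0}) (n : ℕ)
    (hPT : ∀ (κ : ZpExtension ℚ 3) [NumberField (κ.layer n)], κ.IsCyclotomic →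
      poitouTate_selmerStructure_duality (κ.layer n))
    (hX : ClassX4Gord W 3) (hcm : ¬ W.HasCM) (hsurj : Surj W 3) (hr : W.analyticRank = 0)
    (S : Finset (HeightOneSpectrum (𝓞 ℚ))) (m : HeightOneSpectrum (𝓞 ℚ) → ℕ)
    (hSp : ∀ v ∈ S, ((3 : ℕ) : 𝓞 ℚ) ∉ v.asIdeal)
    (hval : ∀ v ∈ S, padicValNat 3 (v.residueCard ^ (3 - 1) - 1) = m v + 1)
    (hcv : ∀ v ∈ S,
      3 ∣ (W.baseChange (v.adicCompletion ℚ)).localTamagawaNumber (v.adicCompletionIntegers ℚ))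
    (hdat : ∀ v ∈ S, W.HasAdditiveReductionAt v ∨ W.HasSplitMultiplicativeReductionAt v)
    (hcert : BranchUnitCoeffAt W 3 (∑ v ∈ S, 3 ^ min n (m v)))
    (hna : ReductionNonAnomalous W 3) : BSDp W 3 :=
  ClassX4Gord.bsdp_three_rankZero_of_katoHalf_of_coeffCert_of_tamagawaCertificates_of_nonAnomalous hK
    hDel98 hDel3 hGZK hmod hmodD h414 hU n hPT
    (fun κ _ _ w =>
      haveI : CharZero (w.adicCompletion (κ.layer n)) :=
        charZero_of_injective_algebraMap (algebraMap (κ.layer n) _).injective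
      EPCTate.localEulerPoincareCharacteristic (w.adicCompletion (κ.layer n)))
    hX hcm hsurj hr S m hSp hval hcv hdat hcert hna

/-- **X3♯(G-ord)@3, `r_an = 0`, non-CM, non-anomalous, `3 ∤ #E(ℚ)_tors` — the END of §2 with `hEP`
discharged by p300886** (`EPCTate.localEulerPoincareCharacteristic`). All other binders verbatim as
in `ClassX3Gord.bsdp_three_rankZero_of_wuthrichHalf_of_coeffCert_of_tamagawaCertificates_of_nonAnomalous`.
Closes no class; literals per row.
[cite: GreenbergLNM1716, §5 pp. 114–118 and Prop. 4.14] [cite: Wuthrich2014, Thm. 16 (p. 397)]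
[cite: Delbourgo2002, Theorem (A), (B) (p. 40), Hypothesis (p. 39)] [cite: MilneADT2006, I §2 Thm 2.8 (p. 31)] -/
theorem ClassX3Gord.bsdp_three_rankZero_of_wuthrichHalf_of_coeffCert_of_tamagawaCertificates_of_nonAnomalous_noEP
    [Fact (Nat.Prime 3)] {W : WeierstrassCurve ℚ} [W.IsElliptic] [W.IsGloballyMinimal]
    (hWu : Wuthrich2014.thm16_halfEigenCharIdeal_dvd_cyclotomicPrime)
    (hDel98 : Delbourgo1998.prop4_rankZero_pow_dvd_constantCoeff)
    (hDel3 : Delbourgo2002.mainTheorem_three)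
    (hGZK : rank_eq_analyticRank_of_analyticRank_le_one) (hmod : hasEntireLFunction_rat)
    (hmodD : nonempty_modularParametrizationData)
    (h414 : Greenberg1999.prop414_noFiniteSubmodule_of_not_dvd_torsionOrder)
    (hU : Silverman1994_thmV53_tateUniformisation.{0}) (n : ℕ)
    (hPT : ∀ (κ : ZpExtension ℚ 3) [NumberField (κ.layer n)], κ.IsCyclotomic →
      poitouTate_selmerStructure_duality (κ.layer n))
    (hX : ClassX3Gord W 3) (hcm : ¬ W.HasCM) (htors : ¬ 3 ∣ W.torsionOrder) (hr : W.analyticRank = 0)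
    (S : Finset (HeightOneSpectrum (𝓞 ℚ))) (m : HeightOneSpectrum (𝓞 ℚ) → ℕ)
    (hSp : ∀ v ∈ S, ((3 : ℕ) : 𝓞 ℚ) ∉ v.asIdeal)
    (hval : ∀ v ∈ S, padicValNat 3 (v.residueCard ^ (3 - 1) - 1) = m v + 1)
    (hcv : ∀ v ∈ S,
      3 ∣ (W.baseChange (v.adicCompletion ℚ)).localTamagawaNumber (v.adicCompletionIntegers ℚ))
    (hdat : ∀ v ∈ S, W.HasAdditiveReductionAt v ∨ W.HasSplitMultiplicativeReductionAt v)
    (hcert : BranchUnitCoeffAt W 3 (∑ v ∈ S, 3 ^ min n (m v)))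
    (hna : ReductionNonAnomalous W 3) : BSDp W 3 :=
  ClassX3Gord.bsdp_three_rankZero_of_wuthrichHalf_of_coeffCert_of_tamagawaCertificates_of_nonAnomalous
    hWu hDel98 hDel3 hGZK hmod hmodD h414 hU n hPT
    (fun κ _ _ w =>
      haveI : CharZero (w.adicCompletion (κ.layer n)) :=
        charZero_of_injective_algebraMap (algebraMap (κ.layer n) _).injective
      EPCTate.localEulerPoincareCharacteristic (w.adicCompletion (κ.layer n)))
    hX hcm htors hr S m hSp hval hcv hdat hcert hna

end Summit.BirchSwinnertonDyer.Rank1Residual.Additive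

namespace Summit.BirchSwinnertonDyer.Rank1Residual.AdditivePotMult

open Summit.BirchSwinnertonDyer.Rank1Residual.Additive
  Summit.BirchSwinnertonDyer.Rank1Residual.GaloisImage

/-- **X4(M)@3 ∧ surj(3), `r_an = 0` — the END of §1 with `hEP` discharged by p300886**
(`EPCTate.localEulerPoincareCharacteristic`). All other binders verbatim as in
`ClassX4M.bsdp_three_rankZero_of_surj_of_katoHalf_of_firstUnitIndex_of_tamagawaCertificates`.
Closes no class; literals per row.
[cite: GreenbergLNM1716, §5 pp. 114–118 and Prop. 4.14] [cite: Kato2004Asterisque, Thm. 17.4 (3) (p. 273)]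
[cite: Delbourgo1998, Prop. 4 (p. 144)] [cite: MilneADT2006, I §2 Thm 2.8 (p. 31)] -/
theorem ClassX4M.bsdp_three_rankZero_of_surj_of_katoHalf_of_firstUnitIndex_of_tamagawaCertificates_noEP
    [Fact (Nat.Prime 3)] {W : WeierstrassCurve ℚ} [W.IsElliptic] [W.IsGloballyMinimal]
    (hK : Wuthrich2014.kato_halfEigenCharIdeal_dvd_cyclotomicPrime_of_surjective)
    (hDel : Delbourgo1998.prop4_rankZero_pow_dvd_constantCoeff)
    (hDelX : Delbourgo1998.prop4_rankZero_constantCoeff_eq_unit_mul_of_potMult)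
    (hPal : Pal2012.thm32_sqrt_mul_realPeriodRat_twist_eq_of_prime_one_mod_four)
    (hGZK : rank_eq_analyticRank_of_analyticRank_le_one) (hmod : hasEntireLFunction_rat)
    (hmodD : nonempty_modularParametrizationData)
    (h414 : Greenberg1999.prop414_noFiniteSubmodule_of_not_dvd_torsionOrder)
    (hU : Silverman1994_thmV53_tateUniformisation.{0}) (n : ℕ)
    (hPT : ∀ (κ : ZpExtension ℚ 3) [NumberField (κ.layer n)], κ.IsCyclotomic →
      poitouTate_selmerStructure_duality (κ.layer n))
    (hX : ClassX4M W 3) (hsurj : Surj W 3) (hr : W.analyticRank = 0)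
    (S : Finset (HeightOneSpectrum (𝓞 ℚ))) (m : HeightOneSpectrum (𝓞 ℚ) → ℕ)
    (hSp : ∀ v ∈ S, ((3 : ℕ) : 𝓞 ℚ) ∉ v.asIdeal)
    (hval : ∀ v ∈ S, padicValNat 3 (v.residueCard ^ (3 - 1) - 1) = m v + 1)
    (hcv : ∀ v ∈ S,
      3 ∣ (W.baseChange (v.adicCompletion ℚ)).localTamagawaNumber (v.adicCompletionIntegers ℚ))
    (hdat : ∀ v ∈ S, W.HasAdditiveReductionAt v ∨ W.HasSplitMultiplicativeReductionAt v)
    (hrec : MultOddFirstUnitIndexAt W 3 (∑ v ∈ S, 3 ^ min n (m v))) : BSDp W 3 :=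
  ClassX4M.bsdp_three_rankZero_of_surj_of_katoHalf_of_firstUnitIndex_of_tamagawaCertificates hK hDel
    hDelX hPal hGZK hmod hmodD h414 hU n hPT
    (fun κ _ _ w =>
      haveI : CharZero (w.adicCompletion (κ.layer n)) :=
        charZero_of_injective_algebraMap (algebraMap (κ.layer n) _).injective
      EPCTate.localEulerPoincareCharacteristic (w.adicCompletion (κ.layer n)))
    hX hsurj hr S m hSp hval hcv hdat hrec

/-- **X3♯(M)@3, `r_an = 0`, `3 ∤ #E(ℚ)_tors` — the END of §2 with `hEP` discharged by p300886**
(`EPCTate.localEulerPoincareCharacteristic`). All other binders verbatim as in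
`ClassX3M.bsdp_three_rankZero_of_wuthrichHalf_of_firstUnitIndex_of_tamagawaCertificates`.
Closes no class; literals per row.
[cite: GreenbergLNM1716, §5 pp. 114–118 and Prop. 4.14] [cite: Wuthrich2014, Thm. 16 (p. 397)]
[cite: Delbourgo1998, Prop. 4 (p. 144)] [cite: MilneADT2006, I §2 Thm 2.8 (p. 31)] -/
theorem ClassX3M.bsdp_three_rankZero_of_wuthrichHalf_of_firstUnitIndex_of_tamagawaCertificates_noEP
    [Fact (Nat.Prime 3)] {W : WeierstrassCurve ℚ} [W.IsElliptic] [W.IsGloballyMinimal]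
    (hW16 : Wuthrich2014.thm16_halfEigenCharIdeal_dvd_cyclotomicPrime)
    (hDel : Delbourgo1998.prop4_rankZero_pow_dvd_constantCoeff)
    (hDelX : Delbourgo1998.prop4_rankZero_constantCoeff_eq_unit_mul_of_potMult)
    (hGZK : rank_eq_analyticRank_of_analyticRank_le_one) (hmod : hasEntireLFunction_rat)
    (hmodD : nonempty_modularParametrizationData)
    (h414 : Greenberg1999.prop414_noFiniteSubmodule_of_not_dvd_torsionOrder)
    (hU : Silverman1994_thmV53_tateUniformisation.{0}) (n : ℕ)
    (hPT : ∀ (κ : ZpExtension ℚ 3) [NumberField (κ.layer n)], κ.IsCyclotomic →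
      poitouTate_selmerStructure_duality (κ.layer n))
    (hX : ClassX3M W 3) (htors : ¬ 3 ∣ W.torsionOrder) (hr : W.analyticRank = 0)
    (S : Finset (HeightOneSpectrum (𝓞 ℚ))) (m : HeightOneSpectrum (𝓞 ℚ) → ℕ)
    (hSp : ∀ v ∈ S, ((3 : ℕ) : 𝓞 ℚ) ∉ v.asIdeal)
    (hval : ∀ v ∈ S, padicValNat 3 (v.residueCard ^ (3 - 1) - 1) = m v + 1)
    (hcv : ∀ v ∈ S,
      3 ∣ (W.baseChange (v.adicCompletion ℚ)).localTamagawaNumber (v.adicCompletionIntegers ℚ))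
    (hdat : ∀ v ∈ S, W.HasAdditiveReductionAt v ∨ W.HasSplitMultiplicativeReductionAt v)
    (hrec : MultOddFirstUnitIndexAt W 3 (∑ v ∈ S, 3 ^ min n (m v))) : BSDp W 3 :=
  ClassX3M.bsdp_three_rankZero_of_wuthrichHalf_of_firstUnitIndex_of_tamagawaCertificates hW16 hDel
    hDelX hGZK hmod hmodD h414 hU n hPT
    (fun κ _ _ w =>
      haveI : CharZero (w.adicCompletion (κ.layer n)) :=
        charZero_of_injective_algebraMap (algebraMap (κ.layer n) _).injective
      EPCTate.localEulerPoincareCharacteristic (w.adicCompletion (κ.layer n)))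
    hX htors hr S m hSp hval hcv hdat hrec

end Summit.BirchSwinnertonDyer.Rank1Residual.AdditivePotMult

end
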